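import Mathlib
import HarnessLib
import Summits.HubbardSuperconductivity.HubbardSuperconductivity.Theorems.KLProgrammeKLRegimeTwoVolumeGridCounterGluingDeep
import Summits.HubbardSuperconductivity.HubbardSuperconductivity.Theorems.KLProgrammeKLRegimeTwoVolumeTorusBlocks

/-!
# Route `KLProgramme` — crux K3, VL child `KLRegimeVolumeLimitV17F2` (stmt-HubbardSuperconductivity-20440), (vi) scale-`0` base (blueprint v4 M4):
# SUPPORT AND WEIGHTED PROFILES OF THE COUNTERTERM'S GLUING DEFECT in the block-periodic residue distance
# (cell gate-hubbard-kl, seat hubbard-kl-k3c4-p1 g11; `--supports` stmt-…-20440; sequel of `…TwoVolumeGridCounterGluing(Arith|Deep)`)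

The two-volume STEP (`…TwoVolumeStepMajorant.sum_norm_kernel_twoVolume_step_le_linear`) reads the input defect and the glued input in profiles WEIGHTED by
`diamWeight φ d′` for the fine label distance `d′` of the step.  On nested tori the right `d′` is the COARSE torus distance of the RESIDUES (block-periodic:
`d′ X′ Y′ = tnorm_L (x̄′ − ȳ′)`, as in `…TwoVolumeTorusBlocks` / k3c5-p2's `hm1′`): in it the glued counterterm's hoppings — even the ones that wrap inside a
block — have length `≤ K.degree`, like the fine ones.  This file:

* §1 torus facts: `tnorm_harmonicShift_le`, `tnorm_le_degree_of_framePosKernel_ne_zero` (the hopping kernel `Ǩ_P` is supported in the sup-ball of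
  radius `K.degree`), `tnorm_residue_sub_le` (residue distance ≤ fine distance);
* §2 closed forms of the two-leg kernels of the fine counterterm (`kernel_two_hubbardGridCounterQuadratic_eq`) and of the glued one
  (`kernel_two_glue_hubbardGridCounterQuadratic_eq`), hence their SUPPORT in residue distance `≤ K.degree`
  (`tnorm_residue_le_of_kernel_counter_ne_zero`, `tnorm_residue_le_of_kernel_glueCounter_ne_zero`);
* §3 WEIGHTED pinned profiles for any nonnegative string weight `wt` that is `≤ Φ` on two-leg strings of residue length `≤ D` (`D ≥` the degrees):
  fine `≤ Φ·(|β|/N)·coeffNorm 0 K`, glued `≤ Φ·(|β|/N)·coeffNorm 0 K`, and the input defect **`sum_wt_norm_kernel_counterGlueDefect_le`**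
  `≤ Φ·(|β|/N)·(coeffNorm 0 K″ + coeffNorm 0 K)` — the `hND` input of the scale-`0` STEP (with `wt = diamWeight φ d′`, `Φ = φ D`).

Everything is proved; no definition.  References: BGM 2003 §1.2 (2.10); Salmhofer 1999 §4.2.4, §4.3.
-/

noncomputable section

namespace Summit.HubbardSuperconductivity.HubbardSuperconductivity.Theorems.TwoVolumeDefect

set_option linter.dupNamespace false -- summit = problem name (single-conjunct summit), D-0017

open Finset Literature.MathematicalPhysics.QuantumLattice GrassmannAlgebra Literature.Probability.LatticeModels
open Summit.HubbardSuperconductivity.HubbardSuperconductivity.Theorems.KLRegimeSplit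

/-! ## §1 Torus facts: the hopping kernel is supported in the ball of radius `K.degree` -/

section Torus

variable {P : ℕ} [NeZero P]

/-- The shifts of a harmonic have torus norm `≤ max m n`. [folklore] -/
theorem tnorm_harmonicShift_le (m n : ℕ) (e : Fin 2 × Fin 2 × Fin 2) : Torus.tnorm (harmonicShift P m n e) ≤ max m n := by
  obtain ⟨s, hs, hsP⟩ := exists_int_harmonicShift m n e
  rw [hsP P, show (fun i => ((s i : ℤ) : ZMod P)) = Torus.proj P s from rfl]
  exact (Torus.tnorm_proj_le s).trans (Site.supNorm_le_iff.2 hs)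

/-- **The frame's hopping kernel is supported in the sup-ball of radius `K.degree`**: `Ǩ_P(z) ≠ 0 ⟹ ‖z‖_𝕋 ≤ K.degree`. [folklore] -/
theorem tnorm_le_degree_of_framePosKernel_ne_zero (K : TrigPolyC4v) {z : TorusSite 2 P} (h : framePosKernel P K z ≠ 0) :
    Torus.tnorm z ≤ K.degree := by
  classical
  rw [framePosKernel_eq_sum] at h
  obtain ⟨m, hm, h1⟩ := exists_ne_zero_of_sum_ne_zero h
  obtain ⟨n, hn, h2⟩ := exists_ne_zero_of_sum_ne_zero h1
  have h3 : harmonicPosKernel P m n z ≠ 0 := fun h0 => h2 (by rw [h0, mul_zero])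
  rw [harmonicPosKernel_eq] at h3
  have h4 : ∑ e : Fin 2 × Fin 2 × Fin 2, (if z = harmonicShift P m n e then (1 : ℂ) else 0) ≠ 0 := fun h0 => h3 (by rw [h0, mul_zero])
  obtain ⟨e, -, h5⟩ := exists_ne_zero_of_sum_ne_zero h4
  have hz : z = harmonicShift P m n e := by
    by_contra hne
    exact h5 (if_neg hne)
  rw [hz]
  refine (tnorm_harmonicShift_le m n e).trans (max_le ?_ ?_)
  · have := mem_range.1 hm; omega
  · have := mem_range.1 hn; omega

/-- **Residue distance is at most fine distance**: for `L″ = b·L`, `‖x̄′ − ȳ′‖_{𝕋,L} ≤ ‖x′ − y′‖_{𝕋,L″}`. [folklore] -/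
theorem tnorm_residue_sub_le {b L Lf : ℕ} [NeZero L] [NeZero Lf] (hLf : Lf = b * L) (x' y' : TorusSite 2 Lf) :
    Torus.tnorm ((fun i => (((x' i).val : ℕ) : ZMod L)) - fun i => (((y' i).val : ℕ) : ZMod L)) ≤ Torus.tnorm (x' - y') := by
  rw [Torus.tnorm, Site.supNorm_le_iff]
  intro i
  have hdvd : L ∣ Lf := ⟨b, by rw [hLf, mul_comm]⟩
  have hcast : ∀ z : ZMod Lf, ((z.val : ℕ) : ZMod L) = ZMod.castHom hdvd (ZMod L) z := fun z => by
    rw [ZMod.castHom_apply, ZMod.cast_eq_val]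
  have hred : (((x' i).val : ℕ) : ZMod L) - (((y' i).val : ℕ) : ZMod L) = ((((x' i - y' i).val : ℕ)) : ZMod L) := by
    rw [hcast, hcast, hcast, map_sub]
  show (Torus.cRepZ ((((x' i).val : ℕ) : ZMod L) - (((y' i).val : ℕ) : ZMod L))).natAbs ≤ Torus.tnorm (x' - y')
  rw [hred]
  exact (natAbs_cRepZ_red_le hLf (x' i - y' i)).trans (by
    have := natAbs_cRepZ_apply_le_tnorm (x' - y') i
    rwa [Pi.sub_apply] at this)

end Torus

/-! ## §2 Closed forms and support of the fine and the glued counterterm kernels -/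

section Support

variable {b L Lf N : ℕ} [NeZero Lf] [NeZero L]

/-- **The two-leg kernel of the grid counterterm, in closed form**: `kernel 𝒩_{K,P,N} 2 Y = ½(β/N)([Y₀⁺Y₁⁻ match]·Ǩ_P(x₀ − x₁) − [Y₁⁺Y₀⁻ match]·Ǩ_P(x₁ − x₀))`.
[folklore] -/
theorem kernel_two_hubbardGridCounterQuadratic_eq {P : ℕ} [NeZero P] (β' : ℝ) (K : TrigPolyC4v) (Y : Fin 2 → GridLeg (GridPoint P N)) :
    kernel ℂ (hubbardGridCounterQuadratic P N β' K) 2 Y =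
      (2 : ℂ)⁻¹ * ((if ((Y 0).2 = 0 ∧ (Y 1).2 = 1 ∧ (Y 1).1.1.1 = (Y 0).1.1.1 ∧ (Y 1).1.2 = (Y 0).1.2) then
          (((β' / N : ℝ)) : ℂ) * framePosKernel P K ((Y 0).1.1.2 - (Y 1).1.1.2) else 0) -
        (if ((Y 1).2 = 0 ∧ (Y 0).2 = 1 ∧ (Y 0).1.1.1 = (Y 1).1.1.1 ∧ (Y 0).1.2 = (Y 1).1.2) then
          (((β' / N : ℝ)) : ℂ) * framePosKernel P K ((Y 1).1.1.2 - (Y 0).1.1.2) else 0)) := by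
  classical
  rw [hubbardGridCounterQuadratic_eq_sum, kernel_two_structured_eq]
  congr 1
  simp_rw [mul_sub]
  rw [sum_sub_distrib]
  have h1 := sum_indicator_pair_eq (fun i : Fin 2 × (GridPoint P N × TorusSite 2 P) =>
    (((β' / N : ℝ)) : ℂ) * framePosKernel P K (i.2.1.2 - i.2.2)) (Y 0) (Y 1)
  have h2 := sum_indicator_pair_eq (fun i : Fin 2 × (GridPoint P N × TorusSite 2 P) =>
    (((β' / N : ℝ)) : ℂ) * framePosKernel P K (i.2.1.2 - i.2.2)) (Y 1) (Y 0)
  simp only [] at h1 h2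
  have hswap : ∀ i : Fin 2 × (GridPoint P N × TorusSite 2 P),
      (((β' / N : ℝ)) : ℂ) * framePosKernel P K (i.2.1.2 - i.2.2) *
          ((if Y 0 = ((((i.2.1.1, i.2.2), i.1), 1) : GridLeg (GridPoint P N)) then (1 : ℂ) else 0) *
            (if Y 1 = (((i.2.1, i.1), 0) : GridLeg (GridPoint P N)) then (1 : ℂ) else 0)) =
        (((β' / N : ℝ)) : ℂ) * framePosKernel P K (i.2.1.2 - i.2.2) *
          ((if Y 1 = (((i.2.1, i.1), 0) : GridLeg (GridPoint P N)) then (1 : ℂ) else 0) *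
            (if Y 0 = ((((i.2.1.1, i.2.2), i.1), 1) : GridLeg (GridPoint P N)) then (1 : ℂ) else 0)) := fun i => by ring
  simp_rw [hswap]
  rw [h1, h2]

/-- **Support of the fine counterterm kernel in residue distance**: if `kernel 𝒩_{K,L″,N} 2 Y ≠ 0` then the two legs' residues are within `K.degree`
(`L″ = b·L`). [folklore] -/
theorem tnorm_residue_le_of_kernel_counter_ne_zero (hLf : Lf = b * L) (β' : ℝ) (K : TrigPolyC4v) (Y : Fin 2 → GridLeg (GridPoint Lf N))
    (h : kernel ℂ (hubbardGridCounterQuadratic Lf N β' K) 2 Y ≠ 0) :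
    Torus.tnorm ((fun i => ((((Y 0).1.1.2 i).val : ℕ) : ZMod L)) - fun i => ((((Y 1).1.1.2 i).val : ℕ) : ZMod L)) ≤ K.degree := by
  classical
  rw [kernel_two_hubbardGridCounterQuadratic_eq] at h
  refine (tnorm_residue_sub_le hLf _ _).trans ?_
  -- one of the two oriented terms is nonzero
  by_cases h01 : framePosKernel Lf K ((Y 0).1.1.2 - (Y 1).1.1.2) = 0
  · have h10 : framePosKernel Lf K ((Y 1).1.1.2 - (Y 0).1.1.2) ≠ 0 := by
      intro h10
      apply h
      simp only [h01, h10, mul_zero, ite_self, sub_self]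
    have h' := tnorm_le_degree_of_framePosKernel_ne_zero K h10
    have hn := Torus.tnorm_neg_le ((Y 1).1.1.2 - (Y 0).1.1.2)
    rw [neg_sub] at hn
    exact hn.trans h'
  · exact tnorm_le_degree_of_framePosKernel_ne_zero K h01

variable (e : GridLeg (GridPoint Lf N) ≃ (Fin 2 → Fin b) × GridLeg (GridPoint L N))
  (he2 : ∀ X', (e X').2 = (((X'.1.1.1, fun i => (((X'.1.1.2 i).val : ℕ) : ZMod L)), X'.1.2), X'.2))
  (Fe : (Fin 2 → Fin b) → (GridLeg (GridPoint L N) → ℂ) →ₗ[ℂ] (GridLeg (GridPoint Lf N) → ℂ))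
  (hFe : ∀ β v X', Fe β v X' = if (e X').1 = β then v (e X').2 else 0)

include hFe in
/-- **The two-leg kernel of the GLUED coarse counterterm, in closed form** (block labels and projected legs). [folklore] -/
theorem kernel_two_glue_hubbardGridCounterQuadratic_eq (β' : ℝ) (K : TrigPolyC4v) (Y : Fin 2 → GridLeg (GridPoint Lf N)) :
    kernel ℂ (∑ β, ExteriorAlgebra.map (Fe β) (hubbardGridCounterQuadratic L N β' K)) 2 Y =
      (2 : ℂ)⁻¹ * ((if ((e (Y 0)).1 = (e (Y 1)).1 ∧ ((e (Y 0)).2.2 = 0 ∧ (e (Y 1)).2.2 = 1 ∧ (e (Y 1)).2.1.1.1 = (e (Y 0)).2.1.1.1 ∧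
            (e (Y 1)).2.1.2 = (e (Y 0)).2.1.2)) then
          (((β' / N : ℝ)) : ℂ) * framePosKernel L K ((e (Y 0)).2.1.1.2 - (e (Y 1)).2.1.1.2) else 0) -
        (if ((e (Y 1)).1 = (e (Y 0)).1 ∧ ((e (Y 1)).2.2 = 0 ∧ (e (Y 0)).2.2 = 1 ∧ (e (Y 0)).2.1.1.1 = (e (Y 1)).2.1.1.1 ∧
            (e (Y 0)).2.1.2 = (e (Y 1)).2.1.2)) then
          (((β' / N : ℝ)) : ℂ) * framePosKernel L K ((e (Y 1)).2.1.1.2 - (e (Y 0)).2.1.1.2) else 0)) := by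
  classical
  rw [sum_map_blockEmb_hubbardGridCounterQuadratic_eq e Fe hFe, kernel_two_structured_eq]
  congr 1
  simp_rw [mul_sub]
  rw [sum_sub_distrib]
  have h1 := sum_indicator_pair_glue_eq e (fun i : Fin 2 × (GridPoint L N × TorusSite 2 L) =>
    (((β' / N : ℝ)) : ℂ) * framePosKernel L K (i.2.1.2 - i.2.2)) (Y 0) (Y 1)
  have h2 := sum_indicator_pair_glue_eq e (fun i : Fin 2 × (GridPoint L N × TorusSite 2 L) =>
    (((β' / N : ℝ)) : ℂ) * framePosKernel L K (i.2.1.2 - i.2.2)) (Y 1) (Y 0)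
  simp only [] at h1 h2
  have hswap : ∀ j : (Fin 2 → Fin b) × (Fin 2 × (GridPoint L N × TorusSite 2 L)),
      (((β' / N : ℝ)) : ℂ) * framePosKernel L K (j.2.2.1.2 - j.2.2.2) *
          ((if Y 0 = e.symm (j.1, ((((j.2.2.1.1, j.2.2.2), j.2.1), 1) : GridLeg (GridPoint L N))) then (1 : ℂ) else 0) *
            (if Y 1 = e.symm (j.1, (((j.2.2.1, j.2.1), 0) : GridLeg (GridPoint L N))) then (1 : ℂ) else 0)) =
        (((β' / N : ℝ)) : ℂ) * framePosKernel L K (j.2.2.1.2 - j.2.2.2) *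
          ((if Y 1 = e.symm (j.1, (((j.2.2.1, j.2.1), 0) : GridLeg (GridPoint L N))) then (1 : ℂ) else 0) *
            (if Y 0 = e.symm (j.1, ((((j.2.2.1.1, j.2.2.2), j.2.1), 1) : GridLeg (GridPoint L N))) then (1 : ℂ) else 0)) :=
    fun j => by ring
  simp_rw [hswap]
  rw [h1, h2]

include he2 hFe in
/-- **Support of the glued counterterm kernel in residue distance**: if `kernel (Σ_β 𝒩_{K,L,N} ∘ f_β) 2 Y ≠ 0` then the two legs' residues are within
`K.degree`. [folklore] -/
theorem tnorm_residue_le_of_kernel_glueCounter_ne_zero (β' : ℝ) (K : TrigPolyC4v) (Y : Fin 2 → GridLeg (GridPoint Lf N))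
    (h : kernel ℂ (∑ β, ExteriorAlgebra.map (Fe β) (hubbardGridCounterQuadratic L N β' K)) 2 Y ≠ 0) :
    Torus.tnorm ((fun i => ((((Y 0).1.1.2 i).val : ℕ) : ZMod L)) - fun i => ((((Y 1).1.1.2 i).val : ℕ) : ZMod L)) ≤ K.degree := by
  classical
  rw [kernel_two_glue_hubbardGridCounterQuadratic_eq e Fe hFe] at h
  have hx0 : (e (Y 0)).2.1.1.2 = fun i => ((((Y 0).1.1.2 i).val : ℕ) : ZMod L) := by rw [he2]
  have hx1 : (e (Y 1)).2.1.1.2 = fun i => ((((Y 1).1.1.2 i).val : ℕ) : ZMod L) := by rw [he2]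
  rw [hx0, hx1] at h
  by_cases h01 : framePosKernel L K ((fun i => ((((Y 0).1.1.2 i).val : ℕ) : ZMod L)) - fun i => ((((Y 1).1.1.2 i).val : ℕ) : ZMod L)) = 0
  · have h10 : framePosKernel L K ((fun i => ((((Y 1).1.1.2 i).val : ℕ) : ZMod L)) - fun i => ((((Y 0).1.1.2 i).val : ℕ) : ZMod L)) ≠ 0 := by
      intro h10
      apply h
      simp only [h01, h10, mul_zero, ite_self, sub_self]
    have h' := tnorm_le_degree_of_framePosKernel_ne_zero K h10
    have hn := Torus.tnorm_neg_le ((fun i => ((((Y 1).1.1.2 i).val : ℕ) : ZMod L)) - fun i => ((((Y 0).1.1.2 i).val : ℕ) : ZMod L))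
    rw [neg_sub] at hn
    exact hn.trans h'
  · exact tnorm_le_degree_of_framePosKernel_ne_zero K h01

end Support

/-! ## §3 Weighted pinned profiles -/

section Weighted

/-- Weighted sums against a support bound: if `wt ≤ Φ` wherever `f ≠ 0`, then `Σ f·wt ≤ Φ·Σ f` (`f, wt, Φ ≥ 0`). [folklore] -/
theorem sum_mul_wt_le_of_support {α : Type*} (s : Finset α) (f wt : α → ℝ) {Φ : ℝ} (hf0 : ∀ a, 0 ≤ f a)
    (hsupp : ∀ a ∈ s, f a ≠ 0 → wt a ≤ Φ) : ∑ a ∈ s, f a * wt a ≤ Φ * ∑ a ∈ s, f a := by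
  rw [mul_sum]
  refine sum_le_sum fun a ha => ?_
  by_cases h : f a = 0
  · rw [h, zero_mul, mul_zero]
  · rw [mul_comm]
    exact mul_le_mul_of_nonneg_right (hsupp a ha h) (hf0 a)

variable {b L Lf N : ℕ} [NeZero Lf] [NeZero L]
  (e : GridLeg (GridPoint Lf N) ≃ (Fin 2 → Fin b) × GridLeg (GridPoint L N))
  (he2 : ∀ X', (e X').2 = (((X'.1.1.1, fun i => (((X'.1.1.2 i).val : ℕ) : ZMod L)), X'.1.2), X'.2))
  (Fe : (Fin 2 → Fin b) → (GridLeg (GridPoint L N) → ℂ) →ₗ[ℂ] (GridLeg (GridPoint Lf N) → ℂ))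
  (hFe : ∀ β v X', Fe β v X' = if (e X').1 = β then v (e X').2 else 0)

/-- **Weighted pinned profile of the fine counterterm**: for a nonnegative string weight `wt` that is `≤ Φ` on two-leg strings whose legs' residues are within
`D ≥ K.degree`: `Σ_{Y : Y p = w} ‖kernel 𝒩_{K,L″,N} 2 Y‖·wt Y ≤ Φ·(|β|/N)·coeffNorm 0 K`. [folklore] -/
theorem sum_wt_norm_kernel_counter_le (hLf : Lf = b * L) (β' : ℝ) (K : TrigPolyC4v) (p : Fin 2) (w : GridLeg (GridPoint Lf N))
    (wt : (Fin 2 → GridLeg (GridPoint Lf N)) → ℝ) {D : ℕ} {Φ : ℝ} (hΦ : 0 ≤ Φ) (hD : K.degree ≤ D)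
    (hwt : ∀ Y : Fin 2 → GridLeg (GridPoint Lf N),
      Torus.tnorm ((fun i => ((((Y 0).1.1.2 i).val : ℕ) : ZMod L)) - fun i => ((((Y 1).1.1.2 i).val : ℕ) : ZMod L)) ≤ D → wt Y ≤ Φ) :
    ∑ Y ∈ univ.filter (fun Y : Fin 2 → GridLeg (GridPoint Lf N) => Y p = w),
      ‖kernel ℂ (hubbardGridCounterQuadratic Lf N β' K) 2 Y‖ * wt Y ≤ Φ * (|β'| / N * K.coeffNorm 0) := by
  refine (sum_mul_wt_le_of_support _ _ wt (fun Y => norm_nonneg _) fun Y _ hY => hwt Y ?_).trans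
    (mul_le_mul_of_nonneg_left (sum_norm_kernel_hubbardGridCounterQuadratic_le β' K p w) hΦ)
  exact (tnorm_residue_le_of_kernel_counter_ne_zero hLf β' K Y (fun h0 => hY (by rw [h0, norm_zero]))).trans hD

include he2 hFe in
/-- **Weighted pinned profile of the glued coarse counterterm** (same shape). [folklore] -/
theorem sum_wt_norm_kernel_glueCounter_le (β' : ℝ) (K : TrigPolyC4v) (p : Fin 2) (w : GridLeg (GridPoint Lf N))
    (wt : (Fin 2 → GridLeg (GridPoint Lf N)) → ℝ) {D : ℕ} {Φ : ℝ} (hΦ : 0 ≤ Φ) (hD : K.degree ≤ D)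
    (hwt : ∀ Y : Fin 2 → GridLeg (GridPoint Lf N),
      Torus.tnorm ((fun i => ((((Y 0).1.1.2 i).val : ℕ) : ZMod L)) - fun i => ((((Y 1).1.1.2 i).val : ℕ) : ZMod L)) ≤ D → wt Y ≤ Φ) :
    ∑ Y ∈ univ.filter (fun Y : Fin 2 → GridLeg (GridPoint Lf N) => Y p = w),
      ‖kernel ℂ (∑ β, ExteriorAlgebra.map (Fe β) (hubbardGridCounterQuadratic L N β' K)) 2 Y‖ * wt Y ≤ Φ * (|β'| / N * K.coeffNorm 0) := by
  refine (sum_mul_wt_le_of_support _ _ wt (fun Y => norm_nonneg _) fun Y _ hY => hwt Y ?_).trans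
    (mul_le_mul_of_nonneg_left (sum_norm_kernel_glue_hubbardGridCounterQuadratic_le e Fe hFe β' K p w) hΦ)
  exact (tnorm_residue_le_of_kernel_glueCounter_ne_zero e he2 Fe hFe β' K Y (fun h0 => hY (by rw [h0, norm_zero]))).trans hD

include he2 hFe in
/-- **WEIGHTED PINNED PROFILE OF THE COUNTERTERM GLUING DEFECT** (the `hND` input of the scale-`0` STEP): for a nonnegative string weight `≤ Φ` on two-leg
strings of residue length `≤ D`, `D ≥ K.degree, K″.degree`:
`Σ_{Y : Y p = w} ‖kernel (𝒩_{K″,L″,N} − Σ_β 𝒩_{K,L,N} ∘ f_β) 2 Y‖·wt Y ≤ Φ·(|β|/N)·(coeffNorm 0 K″ + coeffNorm 0 K)`. [folklore] -/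
theorem sum_wt_norm_kernel_counterGlueDefect_le (hLf : Lf = b * L) (β' : ℝ) (K K'' : TrigPolyC4v) (p : Fin 2) (w : GridLeg (GridPoint Lf N))
    (wt : (Fin 2 → GridLeg (GridPoint Lf N)) → ℝ) (hwt0 : ∀ Y, 0 ≤ wt Y) {D : ℕ} {Φ : ℝ} (hΦ : 0 ≤ Φ) (hD : K.degree ≤ D) (hD'' : K''.degree ≤ D)
    (hwt : ∀ Y : Fin 2 → GridLeg (GridPoint Lf N),
      Torus.tnorm ((fun i => ((((Y 0).1.1.2 i).val : ℕ) : ZMod L)) - fun i => ((((Y 1).1.1.2 i).val : ℕ) : ZMod L)) ≤ D → wt Y ≤ Φ) :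
    ∑ Y ∈ univ.filter (fun Y : Fin 2 → GridLeg (GridPoint Lf N) => Y p = w),
      ‖kernel ℂ (hubbardGridCounterQuadratic Lf N β' K'' - ∑ β, ExteriorAlgebra.map (Fe β) (hubbardGridCounterQuadratic L N β' K)) 2 Y‖ * wt Y ≤
        Φ * (|β'| / N * (K''.coeffNorm 0 + K.coeffNorm 0)) := by
  calc ∑ Y ∈ univ.filter (fun Y : Fin 2 → GridLeg (GridPoint Lf N) => Y p = w),
        ‖kernel ℂ (hubbardGridCounterQuadratic Lf N β' K'' - ∑ β, ExteriorAlgebra.map (Fe β) (hubbardGridCounterQuadratic L N β' K)) 2 Y‖ * wt Y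
      ≤ ∑ Y ∈ univ.filter (fun Y : Fin 2 → GridLeg (GridPoint Lf N) => Y p = w),
          (‖kernel ℂ (hubbardGridCounterQuadratic Lf N β' K'') 2 Y‖ * wt Y +
            ‖kernel ℂ (∑ β, ExteriorAlgebra.map (Fe β) (hubbardGridCounterQuadratic L N β' K)) 2 Y‖ * wt Y) := by
        refine sum_le_sum fun Y _ => ?_
        rw [← add_mul]
        refine mul_le_mul_of_nonneg_right ?_ (hwt0 Y)
        rw [sub_eq_add_neg, kernel_add, ← neg_one_smul ℂ (∑ β, ExteriorAlgebra.map (Fe β) (hubbardGridCounterQuadratic L N β' K)),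
          kernel_smul, neg_one_mul]
        exact norm_add_le_of_le le_rfl (by rw [norm_neg])
    _ ≤ Φ * (|β'| / N * K''.coeffNorm 0) + Φ * (|β'| / N * K.coeffNorm 0) := by
        rw [sum_add_distrib]
        exact add_le_add (sum_wt_norm_kernel_counter_le hLf β' K'' p w wt hΦ hD'' hwt)
          (sum_wt_norm_kernel_glueCounter_le e he2 Fe hFe β' K p w wt hΦ hD hwt)
    _ = Φ * (|β'| / N * (K''.coeffNorm 0 + K.coeffNorm 0)) := by ring

end Weighted

end Summit.HubbardSuperconductivity.HubbardSuperconductivity.Theorems.TwoVolumeDefect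

end
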